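import Summits.ResolutionOfSingularities.ResolutionOfSingularities.Theorems.PurelyInseparableDim4PolyhedraGame
import Mathlib.Data.Nat.Factorial.Basic
import HarnessLib

/-!
# [OURS · res-dim4-pi PR-9c, part 1b] The BOUNDARY LEMMA: the strict polyhedra game reduces to
  Spivakovsky's weak game (induction on the number of active coordinates)

Cell `res-dim4-pi` (D-0157 DOOR 2, wave 2), brick **PR-9c** (seat `res-dim4-p-10`, «width 10»).  Continues
`PurelyInseparableDim4PolyhedraGame` (the game, `Forces`, the named hypothesis `PolyhedraGame.WeakWin`).

* §3 `PolyhedraGame.forces_strict_of_boundary`: at a position whose least active degree is EXACTLY the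
  threshold `t`, every permissible `J` contains the active support `U` of the minimal points; player B must
  answer outside `U` (inside `U` a minimal point drops below `t` at once); the minimal points then stay
  fixed, and the remaining points play — after the integral rescaling `b ↦ (t! / (t − Σ_U b)) • b` — the
  strict game with threshold `t!` in the coordinates `I ∖ U`.  So the strict game in `I` is won from every
  boundary position once it is won (every threshold) in every `I' ⊊ I`.
* §4 **`PolyhedraGame.forces_strict_of_weakWin`**: if Spivakovsky's weak game is won by player A in every
  `I' ⊆ I` (hypothesis `WeakWin σ I'`, [cite: Spivakovsky1983, Theorem p. 421]), then player A forces the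
  STRICT win from every position in `I`, for every threshold `t > 0`.

[OURS · counted 0 · elementary · AI work weaker than expert review] A combinatorial game; NOTHING here proves
resolution of singularities in dimension ≥ 4 / characteristic `p`.
bears_on: LADDER-RESOLUTION:D157-DOOR2 (res-dim4-pi · PR-9c). Supports stmt-ResolutionOfSingularities-16155
(helper).
-/

set_option linter.dupNamespace false -- mandated namespace of this single-conjunct summit

noncomputable section

namespace Summit.ResolutionOfSingularities.ResolutionOfSingularities.Theorems.PIDim4

namespace PolyhedraGame

open Finset
open Literature.AlgebraicGeometry.Resolution
open Literature.AlgebraicGeometry.Resolution.CentreBlowup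

variable {σ : Type} [DecidableEq σ]

/-! ## §3 The boundary lemma -/

section Boundary

variable (t : ℕ) (I : Finset σ)

/-- The minimal points of a boundary position: active degree exactly `t`. [folklore] -/
def minimalPts (P : Pos σ) : Pos σ := P.filter fun a => degIn I a = t

/-- The active support `{i ∈ I : aᵢ ≠ 0}` of a point. [folklore] -/
def activeSupp (a : σ →₀ ℕ) : Finset σ := I.filter fun i => a i ≠ 0

/-- `U(P)`: the union of the active supports of the minimal points. [folklore] -/
def minimalSupp (P : Pos σ) : Finset σ := (minimalPts t I P).biUnion (activeSupp I)

/-- A BOUNDARY position: every point has active degree `≥ t` and some point has active degree `= t`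
(weakly won, not strictly won). [folklore] -/
def IsBoundary (P : Pos σ) : Prop := (∀ a ∈ P, t ≤ degIn I a) ∧ ∃ a ∈ P, degIn I a = t

/-- The riders constrained by `U`: points with `Σ_U b < t`. [folklore] -/
def riders (U : Finset σ) (P : Pos σ) : Pos σ := P.filter fun b => degIn U b < t

/-- The integral rescaling factor `t! / (t − Σ_U b)` of a rider. [folklore] -/
def coef (U : Finset σ) (b : σ →₀ ℕ) : ℕ := t.factorial / (t - degIn U b)

/-- The rescaled rider `(t! / (t − Σ_U b)) • b`. [folklore] -/
def rescale (U : Finset σ) (b : σ →₀ ℕ) : σ →₀ ℕ := coef t U b • b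

/-- The projected position: the rescaled riders (the sub-game position, threshold `t!`, active
coordinates `I ∖ U`). [folklore] -/
def proj (U : Finset σ) (P : Pos σ) : Pos σ := (riders t U P).image (rescale t U)

variable {t I}

omit [DecidableEq σ] in
/-- Membership in the minimal points. [folklore] -/
theorem mem_minimalPts {P : Pos σ} {a : σ →₀ ℕ} :
    a ∈ minimalPts t I P ↔ a ∈ P ∧ degIn I a = t := Finset.mem_filter

omit [DecidableEq σ] in
/-- Membership in the active support. [folklore] -/
theorem mem_activeSupp {a : σ →₀ ℕ} {i : σ} : i ∈ activeSupp I a ↔ i ∈ I ∧ a i ≠ 0 :=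
  Finset.mem_filter

/-- Membership in `U(P)`: some minimal point has a non-zero coordinate there. [folklore] -/
theorem mem_minimalSupp {P : Pos σ} {i : σ} :
    i ∈ minimalSupp t I P ↔ ∃ a ∈ P, degIn I a = t ∧ i ∈ I ∧ a i ≠ 0 := by
  unfold minimalSupp
  rw [Finset.mem_biUnion]
  constructor
  · rintro ⟨a, ha, hi⟩
    exact ⟨a, (mem_minimalPts.mp ha).1, (mem_minimalPts.mp ha).2, mem_activeSupp.mp hi⟩
  · rintro ⟨a, ha, hdeg, hi⟩
    exact ⟨a, mem_minimalPts.mpr ⟨ha, hdeg⟩, mem_activeSupp.mpr hi⟩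

/-- `U(P) ⊆ I`. [folklore] -/
theorem minimalSupp_subset (P : Pos σ) : minimalSupp t I P ⊆ I := fun i hi => by
  obtain ⟨a, -, -, hiI, -⟩ := mem_minimalSupp.mp hi
  exact hiI

omit [DecidableEq σ] in
/-- Membership in the riders. [folklore] -/
theorem mem_riders {U : Finset σ} {P : Pos σ} {b : σ →₀ ℕ} :
    b ∈ riders t U P ↔ b ∈ P ∧ degIn U b < t := Finset.mem_filter

/-- A boundary position has a non-empty `U` (a minimal point has mass in `I` since `t > 0`). [folklore] -/
theorem minimalSupp_nonempty (ht : 0 < t) {P : Pos σ} (hP : IsBoundary t I P) :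
    (minimalSupp t I P).Nonempty := by
  obtain ⟨a, ha, hdeg⟩ := hP.2
  have hne : degIn I a ≠ 0 := by omega
  obtain ⟨i, hi, hai⟩ : ∃ i ∈ I, a i ≠ 0 := by
    by_contra h
    push Not at h
    exact hne (degIn_eq_zero_iff.mpr h)
  exact ⟨i, mem_minimalSupp.mpr ⟨a, ha, hdeg, hi, hai⟩⟩

/-- Every permissible `J ⊆ I` at a position contains the active support of each minimal point, and each
minimal point has `J`-degree exactly `t`. [folklore] -/
theorem minimal_degIn_eq {P : Pos σ} {J : Finset σ} (hJI : J ⊆ I) (hperm : Permissible t J P)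
    {a : σ →₀ ℕ} (ha : a ∈ P) (hdeg : degIn I a = t) :
    degIn J a = t ∧ ∀ i ∈ I, i ∉ J → a i = 0 :=
  degIn_eq_and_apply_eq_zero_of_minimal hJI hdeg (hperm.2 a ha)

/-- Hence `U ⊆ J` for every permissible `J ⊆ I`. [folklore] -/
theorem minimalSupp_subset_of_permissible {P : Pos σ} {J : Finset σ} (hJI : J ⊆ I)
    (hperm : Permissible t J P) : minimalSupp t I P ⊆ J := fun i hi => by
  obtain ⟨a, ha, hdeg, hiI, hai⟩ := mem_minimalSupp.mp hi
  by_contra hiJ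
  exact hai ((minimal_degIn_eq hJI hperm ha hdeg).2 i hiI hiJ)

/-- **B may not answer inside `U`**: if `j ∈ U(P)` and `J ⊆ I` is permissible, the move `(J, j)` is
strictly won (the minimal point with `a_j ≠ 0` drops to active degree `t − a_j < t`). [folklore] -/
theorem strictWon_move_of_mem_minimalSupp {P : Pos σ} {J : Finset σ} (hJI : J ⊆ I)
    (hperm : Permissible t J P) {j : σ} (hj : j ∈ minimalSupp t I P) :
    StrictWon t I (move t J j P) := by
  obtain ⟨a, ha, hdeg, hjI, haj⟩ := mem_minimalSupp.mp hj
  refine Or.inr ⟨chartExponent t J j a, Finset.mem_image_of_mem _ ha, ?_⟩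
  have h1 := degIn_chartExponent_add hjI t a (J := J)
  have h2 : degIn J a = t := (minimal_degIn_eq hJI hperm ha hdeg).1
  have hpos : 0 < a j := Nat.pos_of_ne_zero haj
  omega

/-- Playing `J = U` itself is permissible as soon as there is no rider. [folklore] -/
theorem permissible_minimalSupp_of_riders_eq_empty (ht : 0 < t) {P : Pos σ} (hP : IsBoundary t I P)
    {U : Finset σ} (hU : minimalSupp t I P = U) (hR : riders t U P = ∅) : Permissible t U P := by
  refine ⟨hU ▸ minimalSupp_nonempty ht hP, fun b hb => ?_⟩
  by_contra hlt
  push Not at hlt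
  have : b ∈ riders t U P := mem_riders.mpr ⟨hb, hlt⟩
  rw [hR] at this
  simp at this

omit [DecidableEq σ] in
/-- Arithmetic of a rider: `r = t − Σ_U b` is positive, `≤ t`, divides `t!`, and `coef * r = t!`,
`coef > 0`. [folklore] -/
theorem coef_mul_eq {U : Finset σ} {b : σ →₀ ℕ} (hb : degIn U b < t) :
    coef t U b * (t - degIn U b) = t.factorial ∧ 0 < coef t U b := by
  have hrpos : 0 < t - degIn U b := by omega
  have hrle : t - degIn U b ≤ t := Nat.sub_le t _
  have hdvd : (t - degIn U b) ∣ t.factorial := Nat.dvd_factorial hrpos hrle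
  refine ⟨Nat.div_mul_cancel hdvd, ?_⟩
  exact Nat.div_pos (Nat.le_of_dvd (Nat.factorial_pos t) hdvd) hrpos

/-- Sub-game permissibility of `Γ` at the projected position pulls back: every rider has `Σ_Γ b ≥ t − Σ_U b`.
[folklore] -/
theorem le_degIn_of_proj_permissible {U Γ : Finset σ} {P : Pos σ}
    (hperm : Permissible t.factorial Γ (proj t U P)) {b : σ →₀ ℕ} (hb : b ∈ P) (hbU : degIn U b < t) :
    t - degIn U b ≤ degIn Γ b := by
  have hmem : rescale t U b ∈ proj t U P :=
    Finset.mem_image_of_mem _ (mem_riders.mpr ⟨hb, hbU⟩)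
  have h := hperm.2 _ hmem
  unfold rescale at h
  rw [degIn_nsmul] at h
  obtain ⟨hcr, hcpos⟩ := coef_mul_eq (t := t) hbU
  rw [← hcr] at h
  exact Nat.le_of_mul_le_mul_left h hcpos

/-- `J = U ∪ Γ` is permissible at the ambient threshold `t` when `Γ` is permissible for the projected
position. [folklore] -/
theorem permissible_union_of_proj (ht : 0 < t) {P : Pos σ} (hP : IsBoundary t I P) {U Γ : Finset σ}
    (hU : minimalSupp t I P = U) (hΓ : Γ ⊆ I \ U)
    (hperm : Permissible t.factorial Γ (proj t U P)) : Permissible t (U ∪ Γ) P := by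
  have hdisj : Disjoint U Γ := by
    refine Finset.disjoint_left.mpr fun i hiU hiΓ => ?_
    exact (Finset.mem_sdiff.mp (hΓ hiΓ)).2 hiU
  refine ⟨(hU ▸ minimalSupp_nonempty ht hP).mono Finset.subset_union_left, fun b hb => ?_⟩
  rw [degIn_union_of_disjoint hdisj]
  by_cases hbU : degIn U b < t
  · have := le_degIn_of_proj_permissible hperm hb hbU
    omega
  · omega

/-- The projection commutes with the moves (for `j ∉ U`): `proj (move t (U ∪ Γ) j P) = move t! Γ j (proj P)`.
[folklore] -/
theorem proj_move {P : Pos σ} {U Γ : Finset σ} {j : σ} (hjU : j ∉ U) (hdisj : Disjoint U Γ)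
    (hperm : Permissible t.factorial Γ (proj t U P)) :
    proj t U (move t (U ∪ Γ) j P) = move t.factorial Γ j (proj t U P) := by
  have hfilt : riders t U (move t (U ∪ Γ) j P) = (riders t U P).image (chartExponent t (U ∪ Γ) j) := by
    ext x
    simp only [mem_riders, move, Finset.mem_image]
    constructor
    · rintro ⟨⟨b, hb, rfl⟩, hlt⟩
      rw [degIn_chartExponent_of_not_mem hjU] at hlt
      exact ⟨b, ⟨hb, hlt⟩, rfl⟩
    · rintro ⟨b, ⟨hbP, hlt⟩, rfl⟩
      refine ⟨⟨b, hbP, rfl⟩, ?_⟩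
      rwa [degIn_chartExponent_of_not_mem hjU]
  unfold proj
  rw [hfilt, Finset.image_image]
  unfold move
  rw [Finset.image_image]
  refine Finset.image_congr fun b hb => ?_
  obtain ⟨hbP, hbU⟩ := mem_riders.mp (Finset.mem_coe.mp hb)
  show rescale t U (chartExponent t (U ∪ Γ) j b) = chartExponent t.factorial Γ j (rescale t U b)
  have hc : coef t U (chartExponent t (U ∪ Γ) j b) = coef t U b := by
    unfold coef
    rw [degIn_chartExponent_of_not_mem hjU]
  unfold rescale
  rw [hc]
  obtain ⟨hcr, -⟩ := coef_mul_eq (t := t) hbU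
  have hsubperm : t - degIn U b ≤ degIn Γ b := le_degIn_of_proj_permissible hperm hbP hbU
  refine smul_chartExponent_eq hcr ?_
  rw [degIn_union_of_disjoint hdisj]
  omega

/-- A strictly won projected point pulls back to a strictly won rider. [folklore] -/
theorem strictWon_of_proj_strictWon {P : Pos σ} {U : Finset σ} (hUI : U ⊆ I)
    (h : ∃ y ∈ proj t U P, degIn (I \ U) y < t.factorial) : StrictWon t I P := by
  obtain ⟨y, hy, hlt⟩ := h
  obtain ⟨b, hb, rfl⟩ := Finset.mem_image.mp hy
  obtain ⟨hbP, hbU⟩ := mem_riders.mp hb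
  refine Or.inr ⟨b, hbP, ?_⟩
  unfold rescale at hlt
  rw [degIn_nsmul] at hlt
  obtain ⟨hcr, hcpos⟩ := coef_mul_eq (t := t) hbU
  rw [← hcr] at hlt
  have hlt' : degIn (I \ U) b < t - degIn U b := Nat.lt_of_mul_lt_mul_left hlt
  have hsplit : degIn (I \ U) b + degIn U b = degIn I b := by
    unfold degIn; exact Finset.sum_sdiff hUI
  omega

/-- Minimal points are fixed by a move `(J, j)` with `J ⊆ I` permissible and `j ∈ I ∖ U`. [folklore] -/
theorem chartExponent_eq_self_of_minimal {P : Pos σ} {J : Finset σ} (hJI : J ⊆ I)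
    (hperm : Permissible t J P) {j : σ} (hjI : j ∈ I) (hjU : j ∉ minimalSupp t I P)
    {a : σ →₀ ℕ} (ha : a ∈ P) (hdeg : degIn I a = t) : chartExponent t J j a = a := by
  have haj : a j = 0 := by
    by_contra h
    exact hjU (mem_minimalSupp.mpr ⟨a, ha, hdeg, hjI, h⟩)
  rw [chartExponent_eq_iff]
  refine ⟨?_, fun i _ => rfl⟩
  rw [haj, (minimal_degIn_eq hJI hperm ha hdeg).1, Nat.sub_self]

/-- After a move `(J, j)` with `j ∈ I ∖ U` from a boundary position, `U` can only grow. [folklore] -/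
theorem minimalSupp_subset_move {P : Pos σ} {J : Finset σ} (hJI : J ⊆ I) (hperm : Permissible t J P)
    {j : σ} (hjI : j ∈ I) (hjU : j ∉ minimalSupp t I P) :
    minimalSupp t I P ⊆ minimalSupp t I (move t J j P) := fun i hi => by
  obtain ⟨a, ha, hdeg, hiI, hai⟩ := mem_minimalSupp.mp hi
  refine mem_minimalSupp.mpr ⟨a, ?_, hdeg, hiI, hai⟩
  have := Finset.mem_image_of_mem (chartExponent t J j) ha
  rwa [chartExponent_eq_self_of_minimal hJI hperm hjI hjU ha hdeg] at this

/-- After a move `(J, j)` with `j ∈ I ∖ U` from a boundary position, the new position, if not strictly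
won, is again a boundary position. [folklore] -/
theorem isBoundary_move {P : Pos σ} (hP : IsBoundary t I P) {J : Finset σ} (hJI : J ⊆ I)
    (hperm : Permissible t J P) {j : σ} (hjI : j ∈ I) (hjU : j ∉ minimalSupp t I P)
    (hnw : ¬ StrictWon t I (move t J j P)) : IsBoundary t I (move t J j P) := by
  obtain ⟨a, ha, hdeg⟩ := hP.2
  refine ⟨fun b hb => ?_, ⟨a, ?_, hdeg⟩⟩
  · by_contra hlt
    push Not at hlt
    exact hnw (Or.inr ⟨b, hb, hlt⟩)
  · have := Finset.mem_image_of_mem (chartExponent t J j) ha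
    rwa [chartExponent_eq_self_of_minimal hJI hperm hjI hjU ha hdeg] at this

/-- **THE BOUNDARY LEMMA.** If the strict game is won by A in every proper subset of active coordinates
(every threshold), then A forces the strict win from every BOUNDARY position in `I`. [folklore] -/
theorem forces_strict_of_boundary (ht : 0 < t)
    (hsub : ∀ I' : Finset σ, I' ⊆ I → I'.card < I.card → ∀ L : ℕ, 0 < L → ∀ Y : Pos σ,
      Forces (StrictWon L I') L I' Y) :
    ∀ (m : ℕ) (P : Pos σ), IsBoundary t I P → (I \ minimalSupp t I P).card = m →
      Forces (StrictWon t I) t I P := by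
  intro m
  induction m using Nat.strong_induction_on with
  | _ m innerIH =>
    intro P hP hm
    -- the fixed support `U₀` of this round and the sub-game it defines
    set U₀ := minimalSupp t I P with hU₀def
    have hU₀I : U₀ ⊆ I := minimalSupp_subset P
    have hU₀ne : U₀.Nonempty := minimalSupp_nonempty ht hP
    have hcard : (I \ U₀).card < I.card := by
      have h1 : (I \ U₀).card + U₀.card = I.card := Finset.card_sdiff_add_card_eq_card hU₀I
      have h2 : 0 < U₀.card := Finset.card_pos.mpr hU₀ne
      omega
    have D : Forces (StrictWon t.factorial (I \ U₀)) t.factorial (I \ U₀) (proj t U₀ P) :=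
      hsub (I \ U₀) Finset.sdiff_subset hcard t.factorial (Nat.factorial_pos t) _
    -- follow the sub-game derivation, for every position projecting onto it with the same `U₀`
    suffices KS : ∀ Y : Pos σ, Forces (StrictWon t.factorial (I \ U₀)) t.factorial (I \ U₀) Y →
        ∀ Q : Pos σ, IsBoundary t I Q → minimalSupp t I Q = U₀ → (I \ minimalSupp t I Q).card = m →
          proj t U₀ Q = Y → Forces (StrictWon t I) t I Q from
      KS _ D P hP rfl hm rfl
    intro Y hY
    induction hY with
    | won hW =>
      intro Q hQ hUQ _ hproj
      rcases hW with hYe | hYlt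
      · -- no rider: play `J = U₀`; every answer of B lands in `U₀` and is strictly won
        have hR : riders t U₀ Q = ∅ := by
          rw [← hproj] at hYe
          exact Finset.image_eq_empty.mp hYe
        have hpermU : Permissible t U₀ Q := permissible_minimalSupp_of_riders_eq_empty ht hQ hUQ hR
        refine Forces.step U₀ hU₀I hpermU fun j hj => Forces.won ?_
        exact strictWon_move_of_mem_minimalSupp hU₀I hpermU (hUQ ▸ hj)
      · rw [← hproj] at hYlt
        exact Forces.won (strictWon_of_proj_strictWon hU₀I hYlt)
    | @step Y Γ hΓ hpermΓ _ ih =>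
      intro Q hQ hUQ hmQ hproj
      rw [← hproj] at hpermΓ ih
      have hdisj : Disjoint U₀ Γ :=
        Finset.disjoint_left.mpr fun i hiU hiΓ => (Finset.mem_sdiff.mp (hΓ hiΓ)).2 hiU
      have hJI : U₀ ∪ Γ ⊆ I := Finset.union_subset hU₀I (hΓ.trans Finset.sdiff_subset)
      have hpermJ : Permissible t (U₀ ∪ Γ) Q := permissible_union_of_proj ht hQ hUQ hΓ hpermΓ
      refine Forces.step (U₀ ∪ Γ) hJI hpermJ fun j hj => ?_
      rcases Finset.mem_union.mp hj with hjU | hjΓ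
      · -- B answered inside `U₀`: strictly won at once
        exact Forces.won (strictWon_move_of_mem_minimalSupp hJI hpermJ (hUQ ▸ hjU))
      · -- B answered in `Γ ⊆ I ∖ U₀`
        have hjI : j ∈ I := (Finset.mem_sdiff.mp (hΓ hjΓ)).1
        have hjU : j ∉ U₀ := (Finset.mem_sdiff.mp (hΓ hjΓ)).2
        have hjUQ : j ∉ minimalSupp t I Q := by rw [hUQ]; exact hjU
        rcases Classical.em (StrictWon t I (move t (U₀ ∪ Γ) j Q)) with hnw | hnw
        · exact Forces.won hnw
        have hQ' : IsBoundary t I (move t (U₀ ∪ Γ) j Q) := isBoundary_move hQ hJI hpermJ hjI hjUQ hnw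
        have hmono : U₀ ⊆ minimalSupp t I (move t (U₀ ∪ Γ) j Q) := by
          have h := minimalSupp_subset_move hJI hpermJ hjI hjUQ
          rwa [hUQ] at h
        rcases Classical.em (minimalSupp t I (move t (U₀ ∪ Γ) j Q) = U₀) with hUeq | hUeq
        · -- same `U₀`: the sub-game derivation continues
          refine ih j hjΓ _ hQ' hUeq ?_ ?_
          · rw [hUeq]; rw [hUQ] at hmQ; exact hmQ
          · exact proj_move hjU hdisj hpermΓ
        · -- `U` grew: fewer free coordinates, the inner induction hypothesis applies
          have hlt : (I \ minimalSupp t I (move t (U₀ ∪ Γ) j Q)).card < m := by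
            have hss : U₀ ⊂ minimalSupp t I (move t (U₀ ∪ Γ) j Q) :=
              Finset.ssubset_iff_subset_ne.mpr ⟨hmono, fun h => hUeq h.symm⟩
            have hsub' : minimalSupp t I (move t (U₀ ∪ Γ) j Q) ⊆ I := minimalSupp_subset _
            have h1 := Finset.card_sdiff_add_card_eq_card hsub'
            have h2 := Finset.card_sdiff_add_card_eq_card hU₀I
            have h3 := Finset.card_lt_card hss
            rw [hUQ] at hmQ
            omega
          exact innerIH _ hlt _ hQ' rfl

end Boundary

/-! ## §4 Strict from weak -/

/-- **STRICT FROM WEAK.** If Spivakovsky's weak game is won by player A in every set of active coordinates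
`I' ⊆ I`, then from every position player A forces the STRICT win in `I`, for every threshold `t > 0`.
(Induction on `#I`: weak forcing first; a weakly-but-not-strictly won position is a boundary position;
the boundary lemma.) [folklore] -/
theorem forces_strict_of_weakWin (I : Finset σ) (hweak : ∀ I' : Finset σ, I' ⊆ I → WeakWin σ I')
    {t : ℕ} (ht : 0 < t) (P : Pos σ) : Forces (StrictWon t I) t I P := by
  -- strong induction on the number of active coordinates, for all subsets, thresholds and positions
  suffices main : ∀ (n : ℕ) (I' : Finset σ), I' ⊆ I → I'.card = n → ∀ L : ℕ, 0 < L → ∀ Y : Pos σ,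
      Forces (StrictWon L I') L I' Y from main _ I subset_rfl rfl t ht P
  intro n
  induction n using Nat.strong_induction_on with
  | _ n IH =>
    intro I' hI'I hcard L hL Y
    have hsub : ∀ I'' : Finset σ, I'' ⊆ I' → I''.card < I'.card → ∀ L' : ℕ, 0 < L' → ∀ Z : Pos σ,
        Forces (StrictWon L' I'') L' I'' Z :=
      fun I'' hI'' hlt L' hL' Z => IH I''.card (hcard ▸ hlt) I'' (hI''.trans hI'I) rfl L' hL' Z
    -- weak forcing first (Spivakovsky), then finish from every weakly won position
    refine (hweak I' hI'I L hL Y).weaken fun Q hQ => ?_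
    rcases Classical.em (StrictWon L I' Q) with hsw | hsw
    · exact Forces.won hsw
    · have hB : IsBoundary L I' Q := by
        refine ⟨fun a ha => ?_, ?_⟩
        · by_contra h
          push Not at h
          exact hsw (Or.inr ⟨a, ha, h⟩)
        · rcases hQ with hQe | ⟨a, ha, hle⟩
          · exact absurd (Or.inl hQe) hsw
          · have hnlt : ¬ degIn I' a < L := fun h => hsw (Or.inr ⟨a, ha, h⟩)
            exact ⟨a, ha, by omega⟩
      exact forces_strict_of_boundary hL hsub _ Q hB rfl

end PolyhedraGame

end Summit.ResolutionOfSingularities.ResolutionOfSingularities.Theorems.PIDim4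

end
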